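import Literature.NumberTheory.EllipticCurves.EndomorphismRingTwoGeneratedProofs
import Literature.NumberTheory.EllipticCurves.IsogenyCompProofs
import HarnessLib

/-!
# Coordinates of a composite of isogenies in `ℤ + ℤφ` for a CM curve (Silverman, *AEC*, Cor. III.9.4)

Topic `NumberTheory/EllipticCurves`; a *proofs* file (D-0014: theorems only — no definition, no named fact).

For an elliptic curve `E/K` (`char K = 0`) with an endomorphism `φ ∈ End_K(E)`, `φ² = [D]`, `D < 0`, and isogenies
`β : E → E₂`, `α : E₂ → E` over `K`, the composite `α ∘ β ∈ End_K(E)` has coordinates in the order `ℤ + ℤφ` after ONE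
uniform denominator: `[2D] ∘ α ∘ β = [m] + [n] ∘ φ` for integers `m, n` (Silverman, *AEC*, Cor. III.9.4: `End(E)` is an order
in `ℚ(φ) = ℚ(√D)`, so `End(E) ⊆ 𝓞_{ℚ(√D)} ⊆ (2D)⁻¹(ℤ + ℤφ)`).  This is the tree's `exists_intCast_mul_eq_of_mem_geomEndRing`
(rational form) sharpened by `exists_two_mul_D_mul_mem_span` (uniform denominator `2D`), read on points for isogeny structures.
Consumer: the `K7r` crux line of `Summits/BirchSwinnertonDyer/Rank1Residual` ((S-D-★′), pen D1128 (3): the composite of the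
record's `K`-isogeny with the base change of a `ℚ`-isogeny to the maximal-order partner is ONE element `(m + n√−7)/14` of
`End(E_K) ⊗ ℚ`; there `D = −7` and `14 = 2·7` costs one power of `7` and a `7`-adic unit).

## References
* [SilvermanAEC2009] J. H. Silverman, *The Arithmetic of Elliptic Curves*, 2nd ed., GTM 106 (2009): Cor. III.9.4, Cor. III.6.3, III.§4.
-/

noncomputable section

open scoped Classical

namespace Literature.NumberTheory.EllipticCurves

-- `_root_`: some import closures declare `Literature.NumberTheory.EllipticCurves.WeierstrassCurve.*`
open _root_.WeierstrassCurve

universe u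

variable {K : Type u} [Field K] [CharZero K] {V V₂ : WeierstrassCurve K} [V.IsElliptic]

/-- **`[2D] ∘ α ∘ β ∈ ℤ + ℤφ`.** For an elliptic curve `E/K`, `char K = 0`, an endomorphism `φ` of `E` over `K` with
`φ ∘ φ = [D]`, `D < 0`, and isogenies `β : E → E₂`, `α : E₂ → E` over `K`: there are integers `m, n` with
`(2D) · α(β(P)) = m · P + n · φ(P)` for every `P ∈ E(K̄)` (`End(E)` is an order in `ℚ(√D)`: the rational form
`N · (α ∘ β) = a + bφ`, `N ≠ 0`, of Cor. III.9.4 — `exists_intCast_mul_eq_of_mem_geomEndRing` — with the uniform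
denominator `2D` of `exists_two_mul_D_mul_mem_span`; isogenies are algebraic, so `α ∘ β, φ ∈ End_{K̄}(E) = geomEndRing`).
[cite: SilvermanAEC2009, Cor. III.9.4 and Cor. III.6.3] -/
theorem exists_int_int_two_mul_D_zsmul_comp_eq (α : Isogeny V₂ V) (β : Isogeny V V₂) (φ : Isogeny V V) {D : ℤ}
    (hD : D < 0) (hφ : ∀ P, φ (φ P) = D • P) :
    ∃ m n : ℤ, ∀ P, (2 * D) • α (β P) = m • P + n • φ P := by
  set c : AddMonoid.End V.geomPoints := (α.comp β).toAddMonoidHom with hcdef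
  set ψ : AddMonoid.End V.geomPoints := φ.toAddMonoidHom with hψdef
  have hc : c ∈ V.geomEndRing := Subring.subset_closure (α.comp β).isAlgebraic
  have hψ : ψ ∈ V.geomEndRing := Subring.subset_closure φ.isAlgebraic
  have hψψ : ψ * ψ = (D : AddMonoid.End V.geomPoints) := by
    refine DFunLike.ext _ _ fun P ↦ ?_
    rw [AddMonoid.End.coe_mul, Function.comp_apply, AddMonoid.End.intCast_apply]
    exact hφ P
  obtain ⟨N, a, b, hN, hNc⟩ := exists_intCast_mul_eq_of_mem_geomEndRing V hψ hD hψψ hc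
  obtain ⟨m, n, hmn⟩ := exists_two_mul_D_mul_mem_span V hψ hD hψψ hc hN hNc
  refine ⟨m, n, fun P ↦ ?_⟩
  have h := congrArg (fun f : AddMonoid.End V.geomPoints ↦ f P) hmn
  simp only [AddMonoid.End.coe_mul, Function.comp_apply, AddMonoid.End.intCast_apply] at h
  exact h

/-- The case `D = −7` read with denominator `14`: `14 · α(β(P)) = m · P + n · φ(P)`.
[cite: SilvermanAEC2009, Cor. III.9.4] -/
theorem exists_int_int_fourteen_zsmul_comp_eq (α : Isogeny V₂ V) (β : Isogeny V V₂) (φ : Isogeny V V)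
    (hφ : ∀ P, φ (φ P) = (-7 : ℤ) • P) :
    ∃ m n : ℤ, ∀ P, (14 : ℤ) • α (β P) = m • P + n • φ P := by
  obtain ⟨m, n, h⟩ := exists_int_int_two_mul_D_zsmul_comp_eq α β φ (by norm_num) hφ
  refine ⟨-m, -n, fun P ↦ ?_⟩
  have hP := h P
  rw [show (2 * -7 : ℤ) = -14 by norm_num, neg_smul, neg_eq_iff_eq_neg, neg_add] at hP
  rw [hP, neg_smul, neg_smul]

end Literature.NumberTheory.EllipticCurves

end
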